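import Literature.NumberTheory.EllipticCurves.PadicPointsFiltrationProofs
import Literature.NumberTheory.EllipticCurves.DivisionPolynomialMultiplication
import Summits.BirchSwinnertonDyer.Rank1Residual.Additive.X4ThreeKuriharaCertKernelPsi3
import HarnessLib

/-!
# `3`-torsion of `E(ℚ₃)` on an integral model: the `x`-coordinates are `3`-adic integers, and the
# fibre count over a root of `Ψ₃` (team n1011, row T-LOC3T, FILE B)

HONEST FRAMING (cell `b2b-bsdres`, run/shared/lean/b2b/bsd-rank1-residual/, verbatim in every
file): the goal of the cell is to DELETE the COMBINATION-SHAPED residual classes of the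
Birch–Swinnerton-Dyer formula for ALL analytic-rank `≤ 1` elliptic curves over `ℚ` — "full BSD
formula for every rank `≤ 1` curve in class `C`" assembled STRICTLY from published theorems — so
that the rank-`≤ 1` remainder becomes exactly the CONSTRUCTION-SHAPED classes, which are TYPED
(missing-input `Prop`s), NOT attempted. This is not "finishing BSD". Team n1011 (N10/N11): research
route; this file is a TOOL (local arithmetic of `E(ℚ₃)`); nothing is booked by it; no mark / label
moved. THEOREMS ONLY: no definition, no named fact, no `sorry`.

## What

For a Weierstrass equation `E` over `ℚ₃` with `3`-integral coefficients (`[E.IsIntegral ℤ_[3]]`)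
and `Δ ≠ 0`:

* `three_nsmul_some_eq_zero_iff_eval_Ψ₃` — an affine point `P = (x, y)` satisfies `3P = O` iff
  `Ψ₃(x) = 0`, `Ψ₃ = 3X⁴ + b₂X³ + 3b₄X² + 3b₆X + b₈` (the tree's PROVED
  `Affine.Point.zsmul_some_eq_zero_iff`, Silverman *AEC* Ex. 3.7, with Mathlib's `ψ 3 = C Ψ₃`).
* **`norm_le_one_of_three_nsmul_eq_zero`** — such a point has `‖x‖₃ ≤ 1`. Proof: otherwise
  `P ∈ E₁(ℚ₃)`, `z = -x/y`, `‖z‖² = ‖x‖⁻¹`; if `‖z‖ < 3⁻¹` the tree's `‖z(3P)‖ = 3⁻¹‖z(P)‖`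
  (`norm_formalParameter_p_nsmul`, AEC IV.3.2) contradicts `3P = O`; else `‖z‖ = 3⁻¹`,
  `‖x‖ = 9`, and in `Ψ₃(x)` the term `3x⁴` of norm `3⁷` strictly dominates the others (norm
  `≤ 3⁶`), so `Ψ₃(x) ≠ 0`. (This replaces AEC VII.3.4's `e < p − 1` argument at `p = 3`,
  `e = 1`, for the single prime the consumers need.)
* `equation_iff_sq_eq_g` — `E(x, y) ⟺ (2y + a₁x + a₃)² = g(x)`,
  `g(x) = 4x³ + b₂x² + 2b₄x + b₆` (any field with `2 ≠ 0`), the fibre equivalence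
  `{y // E(x,y)} ≃ {u // u² = g(x)}` (`nonempty_fibreEquivSqrt`), and the fibre counts
  `natCard_fibre_eq_two` (`g(x)` a non-zero square), `natCard_fibre_eq_zero` (non-square),
  `finite_fibre`.

Consumer: FILE C `LocalThreeTorsionDecider` (`#E(ℚ₃)[3] = 1 + 2·#{roots of Ψ₃ in ℤ₃ with g a
non-zero square}`), which discharges route 1's row binder `ht : #E(ℚ₃)[3] = 3^t`
(r1 ROUTE-1 §27.2). References: [SilvermanAEC2009] III Ex. 3.7, IV.3.2, VII.2.2, VII.3.
-/

set_option autoImplicit false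

noncomputable section

open scoped Classical
open Polynomial WeierstrassCurve

namespace Summit.BirchSwinnertonDyer.Rank1Residual.GaloisImage.LocalTorsion3

/-! ### Fibres of `(x, y) ↦ x`: completing the square -/

section Field

variable {K : Type*} [Field K] (E : WeierstrassCurve K)

/-- **Completing the square**: `y² + a₁xy + a₃y = x³ + a₂x² + a₄x + a₆` iff
`(2y + a₁x + a₃)² = 4x³ + b₂x² + 2b₄x + b₆`, when `2 ≠ 0` in `K`. [Silverman AEC III.1
(`b`-invariants)] [folklore] -/
theorem equation_iff_sq_eq_g (h2 : (2 : K) ≠ 0) (x y : K) :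
    E.toAffine.Equation x y ↔
      (2 * y + E.a₁ * x + E.a₃) ^ 2 = 4 * x ^ 3 + E.b₂ * x ^ 2 + 2 * E.b₄ * x + E.b₆ := by
  rw [Affine.equation_iff]
  constructor
  · intro h
    simp only [b₂, b₄, b₆]
    linear_combination 4 * h
  · intro h
    have h4 : (4 : K) ≠ 0 := by
      have : (4 : K) = 2 * 2 := by norm_num
      rw [this]; exact mul_ne_zero h2 h2
    apply mul_left_cancel₀ h4
    simp only [b₂, b₄, b₆] at h
    linear_combination h

/-- The fibre of `x` in `E(K)` is in bijection with the square roots of `g(x)`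
(`u = 2y + a₁x + a₃`; stated as `Nonempty (_ ≃ _)` to keep this file definition-free). [folklore] -/
theorem nonempty_fibreEquivSqrt (h2 : (2 : K) ≠ 0) (x : K) :
    Nonempty ({y : K // E.toAffine.Equation x y} ≃
      {u : K // u ^ 2 = 4 * x ^ 3 + E.b₂ * x ^ 2 + 2 * E.b₄ * x + E.b₆}) := by
  refine ⟨{ toFun := fun y => ⟨2 * y.1 + E.a₁ * x + E.a₃, (equation_iff_sq_eq_g E h2 x y.1).mp y.2⟩,
             invFun := fun u => ⟨(u.1 - E.a₁ * x - E.a₃) / 2, ?_⟩,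
             left_inv := fun y => ?_,
             right_inv := fun u => ?_ }⟩
  · rw [equation_iff_sq_eq_g E h2]
    have : 2 * ((u.1 - E.a₁ * x - E.a₃) / 2) + E.a₁ * x + E.a₃ = u.1 := by
      field_simp; ring
    rw [this]; exact u.2
  · apply Subtype.ext
    show (2 * y.1 + E.a₁ * x + E.a₃ - E.a₁ * x - E.a₃) / 2 = y.1
    field_simp; ring
  · apply Subtype.ext
    show 2 * ((u.1 - E.a₁ * x - E.a₃) / 2) + E.a₁ * x + E.a₃ = u.1
    field_simp; ring

omit E in
/-- `#{u : K // u² = d} = 2` when `d = s²` with `s ≠ 0` and `2 ≠ 0` (the two roots `±s`).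
[folklore] -/
theorem natCard_sq_eq_two {d : K} (h2 : (2 : K) ≠ 0) (hd : IsSquare d) (hd0 : d ≠ 0) :
    Nat.card {u : K // u ^ 2 = d} = 2 := by
  obtain ⟨s, rfl⟩ := hd
  have hs0 : s ≠ 0 := fun h => hd0 (by rw [h, mul_zero])
  have hne : s ≠ -s := by
    intro h
    have : (2 : K) * s = 0 := by linear_combination h
    rcases mul_eq_zero.mp this with h | h
    · exact h2 h
    · exact hs0 h
  have key : ∀ u : K, u ^ 2 = s * s ↔ u = s ∨ u = -s := by
    intro u; rw [← pow_two, sq_eq_sq_iff_eq_or_eq_neg]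
  let e : {u : K // u ^ 2 = s * s} ≃ Bool :=
    { toFun := fun u => decide (u.1 = s)
      invFun := fun b => if b then ⟨s, by ring⟩ else ⟨-s, by ring⟩
      left_inv := by
        rintro ⟨u, hu⟩
        rcases (key u).mp hu with h | h
        · simp [h]
        · have : ¬ (-s = s) := fun h' => hne h'.symm
          simp [h, this]
      right_inv := by
        intro b
        cases b
        · have : ¬ (-s = s) := fun h => hne h.symm
          simp [this]
        · simp }
  rw [Nat.card_congr e, Nat.card_eq_fintype_card, Fintype.card_bool]

omit E in
/-- `#{u : K // u² = d} = 0` when `d` is not a square. [folklore] -/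
theorem natCard_sq_eq_zero {d : K} (hd : ¬ IsSquare d) : Nat.card {u : K // u ^ 2 = d} = 0 := by
  have : IsEmpty {u : K // u ^ 2 = d} := ⟨fun u => hd ⟨u.1, by rw [← pow_two]; exact u.2.symm⟩⟩
  exact Nat.card_of_isEmpty

omit E in
/-- `{u : K // u² = d}` is finite (at most the two roots `±s`, or empty). [folklore] -/
theorem finite_sq (d : K) : Finite {u : K // u ^ 2 = d} := by
  by_cases hd : IsSquare d
  · obtain ⟨s, rfl⟩ := hd
    have hsub : {u : K | u ^ 2 = s * s} ⊆ ({s, -s} : Set K) := by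
      intro u hu
      rw [Set.mem_setOf_eq, ← pow_two, sq_eq_sq_iff_eq_or_eq_neg] at hu
      rcases hu with h | h
      · exact Or.inl h
      · exact Or.inr h
    exact (((Set.finite_singleton (-s)).insert s).subset hsub).to_subtype
  · haveI : IsEmpty {u : K // u ^ 2 = d} :=
      ⟨fun u => hd ⟨u.1, by rw [← pow_two]; exact u.2.symm⟩⟩
    infer_instance

/-- The fibre `{y // E(x,y)}` is finite (when `2 ≠ 0`). [folklore] -/
theorem finite_fibre (h2 : (2 : K) ≠ 0) (x : K) : Finite {y : K // E.toAffine.Equation x y} :=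
  haveI := finite_sq (4 * x ^ 3 + E.b₂ * x ^ 2 + 2 * E.b₄ * x + E.b₆)
  let ⟨e⟩ := nonempty_fibreEquivSqrt E h2 x
  Finite.of_equiv _ e.symm

/-- Fibre count, square case: `#{y // E(x,y)} = 2` if `g(x)` is a non-zero square. [folklore] -/
theorem natCard_fibre_eq_two (h2 : (2 : K) ≠ 0) (x : K)
    (hsq : IsSquare (4 * x ^ 3 + E.b₂ * x ^ 2 + 2 * E.b₄ * x + E.b₆))
    (hne : 4 * x ^ 3 + E.b₂ * x ^ 2 + 2 * E.b₄ * x + E.b₆ ≠ 0) :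
    Nat.card {y : K // E.toAffine.Equation x y} = 2 := by
  obtain ⟨e⟩ := nonempty_fibreEquivSqrt E h2 x
  rw [Nat.card_congr e]; exact natCard_sq_eq_two h2 hsq hne

/-- Fibre count, non-square case: `#{y // E(x,y)} = 0`. [folklore] -/
theorem natCard_fibre_eq_zero (h2 : (2 : K) ≠ 0) (x : K)
    (hsq : ¬ IsSquare (4 * x ^ 3 + E.b₂ * x ^ 2 + 2 * E.b₄ * x + E.b₆)) :
    Nat.card {y : K // E.toAffine.Equation x y} = 0 := by
  obtain ⟨e⟩ := nonempty_fibreEquivSqrt E h2 x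
  rw [Nat.card_congr e]; exact natCard_sq_eq_zero hsq

end Field

/-! ### Over `ℚ₃`: `3P = O ⟺ Ψ₃(x) = 0`, and `x` is a `3`-adic integer -/

section Padic

variable (E : WeierstrassCurve ℚ_[3]) [hE : E.IsIntegral ℤ_[3]]

omit hE in
/-- **`3P = O ⟺ Ψ₃(x(P)) = 0`** for an affine point `P = (x, y)` of `E/ℚ₃`
(Silverman AEC Ex. 3.7(f), the tree's `Affine.Point.zsmul_some_eq_zero_iff`, with `ψ₃ = C Ψ₃`).
[cite: SilvermanAEC2009, Exercise 3.7(f)] -/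
theorem three_nsmul_some_eq_zero_iff_eval_Ψ₃ {x y : ℚ_[3]} (h : E.toAffine.Nonsingular x y) :
    (3 : ℕ) • (Affine.Point.some x y h : E.toAffine.Point) = 0 ↔ E.Ψ₃.eval x = 0 := by
  have key := Affine.Point.zsmul_some_eq_zero_iff h (3 : ℤ)
  rw [show ((3 : ℤ)) = ((3 : ℕ) : ℤ) by rfl, natCast_zsmul] at key
  rw [key, show ((3 : ℕ) : ℤ) = 3 by rfl, WeierstrassCurve.ψ_three, evalEval_C]

/-- The `b`-invariants of a `3`-integral equation have norm `≤ 1`. [folklore] -/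
theorem norm_b_le_one : ‖E.b₂‖ ≤ 1 ∧ ‖E.b₄‖ ≤ 1 ∧ ‖E.b₆‖ ≤ 1 ∧ ‖E.b₈‖ ≤ 1 := by
  obtain ⟨Ei, hEi⟩ := hE.integral
  have hn : ∀ t : ℤ_[3], ‖algebraMap ℤ_[3] ℚ_[3] t‖ ≤ 1 := fun t => by
    rw [PadicInt.algebraMap_apply, ← PadicInt.norm_def]; exact PadicInt.norm_le_one t
  have h2 : E.b₂ = algebraMap ℤ_[3] ℚ_[3] Ei.b₂ := by
    rw [hEi]; simp only [WeierstrassCurve.baseChange, WeierstrassCurve.map_b₂]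
  have h4 : E.b₄ = algebraMap ℤ_[3] ℚ_[3] Ei.b₄ := by
    rw [hEi]; simp only [WeierstrassCurve.baseChange, WeierstrassCurve.map_b₄]
  have h6 : E.b₆ = algebraMap ℤ_[3] ℚ_[3] Ei.b₆ := by
    rw [hEi]; simp only [WeierstrassCurve.baseChange, WeierstrassCurve.map_b₆]
  have h8 : E.b₈ = algebraMap ℤ_[3] ℚ_[3] Ei.b₈ := by
    rw [hEi]; simp only [WeierstrassCurve.baseChange, WeierstrassCurve.map_b₈]
  rw [h2, h4, h6, h8]
  exact ⟨hn _, hn _, hn _, hn _⟩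

/-- If `‖x‖₃ = 9` then `Ψ₃(x) ≠ 0` on a `3`-integral equation: the term `3x⁴` (norm `3⁷`) strictly
dominates `b₂x³ + 3b₄x² + 3b₆x + b₈` (norm `≤ 3⁶`). [folklore] -/
theorem eval_Ψ₃_ne_zero_of_norm_eq_nine {x : ℚ_[3]} (hx : ‖x‖ = 9) : E.Ψ₃.eval x ≠ 0 := by
  obtain ⟨h2, h4, h6, h8⟩ := norm_b_le_one E
  have h3 : ‖(3 : ℚ_[3])‖ = 3⁻¹ := by exact_mod_cast Padic.norm_p (p := 3)
  rw [Additive.eval_psi3_eq]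
  have hlead : ‖(3 : ℚ_[3]) * x ^ 4‖ = 3 ^ 7 := by
    rw [norm_mul, norm_pow, h3, hx]; norm_num
  have hrest : ‖E.b₂ * x ^ 3 + 3 * E.b₄ * x ^ 2 + 3 * E.b₆ * x + E.b₈‖ ≤ 3 ^ 6 := by
    have t1 : ‖E.b₂ * x ^ 3‖ ≤ 3 ^ 6 := by
      rw [norm_mul, norm_pow, hx]
      nlinarith [norm_nonneg E.b₂]
    have t2 : ‖3 * E.b₄ * x ^ 2‖ ≤ 3 ^ 6 := by
      rw [norm_mul, norm_mul, norm_pow, hx, h3]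
      nlinarith [norm_nonneg E.b₄]
    have t3 : ‖3 * E.b₆ * x‖ ≤ 3 ^ 6 := by
      rw [norm_mul, norm_mul, hx, h3]
      nlinarith [norm_nonneg E.b₆]
    have t4 : ‖E.b₈‖ ≤ 3 ^ 6 := h8.trans (by norm_num)
    refine (Padic.nonarchimedean _ _).trans (max_le ?_ t4)
    refine (Padic.nonarchimedean _ _).trans (max_le ?_ t3)
    exact (Padic.nonarchimedean _ _).trans (max_le t1 t2)
  have hne : ‖(3 : ℚ_[3]) * x ^ 4‖ ≠ ‖E.b₂ * x ^ 3 + 3 * E.b₄ * x ^ 2 + 3 * E.b₆ * x + E.b₈‖ := by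
    rw [hlead]; intro h; rw [← h] at hrest; norm_num at hrest
  intro h0
  have hsum :
      (3 : ℚ_[3]) * x ^ 4 + (E.b₂ * x ^ 3 + 3 * E.b₄ * x ^ 2 + 3 * E.b₆ * x + E.b₈) = 0 := by
    rw [← h0]; ring
  have := Padic.add_eq_max_of_ne hne
  rw [hsum, norm_zero, hlead] at this
  have : (3 : ℝ) ^ 7 ≤ 0 := by rw [this]; exact le_max_left _ _
  norm_num at this

variable [E.IsElliptic]

/-- **The `x`-coordinate of a `ℚ₃`-rational `3`-torsion point of a `3`-integral equation is a
`3`-adic integer.** [Silverman AEC IV.3.2, VII.2.2, VII.3] [folklore] -/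
theorem norm_le_one_of_three_nsmul_eq_zero {x y : ℚ_[3]} (h : E.toAffine.Nonsingular x y)
    (h3 : (3 : ℕ) • (Affine.Point.some x y h : E.toAffine.Point) = 0) : ‖x‖ ≤ 1 := by
  by_contra hx
  rw [not_le] at hx
  set P : E.toAffine.Point := Affine.Point.some x y h with hP
  have hPk : E.IsInReductionKernel P := (E.isInReductionKernel_some h).mpr hx
  have hzx : ‖E.formalParameter P‖ ^ 2 = ‖x‖⁻¹ := by
    rw [hP, E.formalParameter_some h]; exact E.norm_formalParameter_sq h.left hx
  by_cases hlt : ‖E.formalParameter P‖ < (3 : ℝ)⁻¹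
  · -- `‖z(3P)‖ = 3⁻¹ ‖z(P)‖ ≠ 0`
    have key := E.norm_formalParameter_p_nsmul hPk (by exact_mod_cast hlt)
    rw [h3, E.formalParameter_zero, norm_zero] at key
    have hz0 : E.formalParameter P = 0 := by
      have : ‖E.formalParameter P‖ = 0 := by
        have h3pos : (0 : ℝ) < ((3 : ℕ) : ℝ)⁻¹ := by norm_num
        nlinarith [norm_nonneg (E.formalParameter P)]
      exact norm_eq_zero.mp this
    have : P = 0 := (E.formalParameter_eq_zero_iff hPk).mp hz0
    exact absurd this (by rw [hP]; rintro ⟨⟩)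
  · -- `‖z‖ = 3⁻¹`, so `‖x‖ = 9`
    rw [not_lt] at hlt
    have hlt1 : ‖E.formalParameter P‖ < 1 := E.norm_formalParameter_lt_one hPk
    have hle : ‖E.formalParameter P‖ ≤ (3 : ℝ)⁻¹ := by
      have := (Padic.norm_le_pow_iff_norm_lt_pow_add_one (E.formalParameter P) (-1)).mpr
        (by norm_num; exact hlt1)
      simpa using this
    have hz : ‖E.formalParameter P‖ = (3 : ℝ)⁻¹ := le_antisymm hle hlt
    have hx9 : ‖x‖ = 9 := by
      rw [hz] at hzx
      have hx0 : ‖x‖ ≠ 0 := (one_pos.trans hx).ne'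
      field_simp at hzx
      nlinarith [hzx]
    exact eval_Ψ₃_ne_zero_of_norm_eq_nine E hx9 ((three_nsmul_some_eq_zero_iff_eval_Ψ₃ E h).mp h3)

end Padic

end Summit.BirchSwinnertonDyer.Rank1Residual.GaloisImage.LocalTorsion3

end
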